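import Mathlib
import Summits.Langlands.Langlands.Theorems.PicardMuOrdinaryResidualAutomorphyOddCore
import Summits.Langlands.Langlands.Theorems.PicardMuOrdinaryResidualAutomorphyOddFacts
import HarnessLib

/-!
# The automorphic side of `ResidualAutomorphyOdd` (helper for item stmt-Langlands-13759, route PicardMuOrdinary)

From a newform `g` of weight `k ≥ 2` whose mod-`3` representation is non-dihedral in the sense of the
Galois side, and a finite-order Hecke character `ω`: the cuspidal automorphic representation
`P = BC_{K/ℚ}(Ad(π_g) ⊗ ω ⊗ |det|^{2-k})` of `GL₃(𝔸_K)`, `K = ℚ(ω)`, regular algebraic, with its Satake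
parameters at almost all places (`automorphicSide`), conditional on the Gelbart–Jacquet archimedean
clause, the archimedean parameter of newforms, cyclic base change and Arthur–Clozel's archimedean
lifting (named facts).
-/

set_option linter.dupNamespace false -- project-wide option (lakefile weak.linter.dupNamespace); `Summit.Langlands.Langlands` is the mandated namespace

noncomputable section

open scoped NumberField Classical Polynomial MatrixGroups
open Filter IsDedekindDomain Polynomial
open Literature.NumberTheory.Automorphic Literature.NumberTheory.GaloisRepresentations
open Literature.NumberTheory.EllipticCurves.ModularForms

namespace Summit.Langlands.Langlands.Theorems.ResidualAutomorphyOdd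

/-! ### Automorphic side -/

section AutomorphicSide

/-- The cuspidal automorphic representation datum of a newform of weight `k ≥ 2`, at the level of
Satake parameters almost everywhere (Gelbart's dictionary, proved in the tree, transported from the
`L²` model to the Borel–Jacquet model). -/
theorem exists_repData_of_newform {N : ℕ} [NeZero N] {k : ℤ} (hk : 2 ≤ k)
    {f : CuspForm (CongruenceSubgroup.Gamma1 N) k} (hf : IsNewform1 f)
    (hcpt : isCompact_glFiniteIntegralLevel 2 ℚ) :
    ∃ π : CuspidalAutomorphicRepData 2 ℚ hcpt,
      ∀ᶠ v : HeightOneSpectrum (𝓞 ℚ) in Filter.cofinite, ∃ α β : ℂ, π.1.HasSatakeParamAt v {α, β} ∧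
        α + β = heckeEigenvalue f (Rat.HeightOneSpectrum.primesEquiv v) /
            (((Real.sqrt (Rat.HeightOneSpectrum.primesEquiv v : ℕ) : ℝ) : ℂ) ^ (k - 1)) ∧
        α * β = nebentypus f (Rat.HeightOneSpectrum.primesEquiv v : ℕ) := by
  obtain ⟨μ, hμ, P, 𝔫, h𝔫, hP⟩ := Gelbart1975_exists_isAutomorphicRepOf_holds (N := N) (k := k) hk hf
  obtain ⟨π, -, hπ⟩ := P.exists_cuspidalRepData_hasSatakeParamAt hcpt
  refine ⟨π, ?_⟩
  filter_upwards [hP, hπ] with v hv hπv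
  obtain ⟨hv𝔫, α, β, hαβ, hαβ', ϖ, hS⟩ := hv
  exact ⟨α, β, hπv 𝔫 ϖ {α, β} h𝔫 hv𝔫 hS, hαβ, hαβ'⟩

/-- The twisted adjoint infinity type is regular algebraic for `k ≥ 2`. -/
theorem isRegularAlgebraic_adInfinityType_twist {k : ℤ} (hk : 2 ≤ k) (s : ℤ) :
    ((adInfinityType k).twist (s : ℂ)).IsRegularAlgebraic := by
  constructor
  · intro σ p hp
    simp only [InfinityType.twist_apply, adInfinityType, Multiset.insert_eq_cons, Multiset.map_cons,
      Multiset.map_singleton, Multiset.mem_cons, Multiset.mem_singleton] at hp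
    rcases hp with rfl | rfl | rfl
    · exact ⟨k - 1 + s - 1, 1 - k + s - 1, by push_cast; simp; ring, by push_cast; simp; ring⟩
    · exact ⟨1 - k + s - 1, k - 1 + s - 1, by push_cast; simp; ring, by push_cast; simp; ring⟩
    · exact ⟨s - 1, s - 1, by push_cast; simp; ring, by push_cast; simp; ring⟩
  · intro σ
    simp only [InfinityType.twist_apply, adInfinityType, Multiset.insert_eq_cons, Multiset.map_cons,
      Multiset.map_singleton, ArchWeight.twist_a]
    simp only [Multiset.nodup_cons, Multiset.mem_cons, Multiset.mem_singleton, Multiset.nodup_singleton,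
      and_true, not_or]
    have hk' : ((k : ℂ) - 1) ≠ 0 := by
      have : (k : ℂ) ≠ 1 := by exact_mod_cast (show k ≠ 1 by omega)
      exact sub_ne_zero.2 this
    refine ⟨⟨?_, ?_⟩, ?_⟩
    · intro h
      apply hk'
      linear_combination h / 2
    · intro h
      apply hk'
      linear_combination h
    · intro h
      apply hk'
      linear_combination -h

/-- Transport of an eventual property from the places of `ℚ` to the places of `K` above them. -/
theorem eventually_over {Q : HeightOneSpectrum (𝓞 ℚ) → Prop}
    (h : ∀ᶠ v : HeightOneSpectrum (𝓞 ℚ) in cofinite, Q v) :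
    ∀ᶠ 𝔭 : HeightOneSpectrum (𝓞 Kω) in cofinite, ∀ v : HeightOneSpectrum (𝓞 ℚ),
      𝔭.asIdeal.under (𝓞 ℚ) = v.asIdeal → Q v := by
  rw [Filter.eventually_cofinite] at h ⊢
  refine (finite_setOf_under_mem h).subset ?_
  intro 𝔭 h𝔭
  simp only [Set.mem_setOf_eq, not_forall, exists_prop] at h𝔭
  obtain ⟨v, hv, hQ⟩ := h𝔭
  exact ⟨v, hQ, hv⟩

/-- An adjoint-shaped Satake parameter is not fixed by `-1`. -/
theorem map_neg_ne_of_adjoint {c r : ℂ} (hc : c ≠ 0) (hr : r ≠ 0) :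
    ({c * r, c * r⁻¹, c} : Multiset ℂ).map ((-1 : ℂ) * ·) ≠ ({c * r, c * r⁻¹, c} : Multiset ℂ) := by
  intro h
  have hmem : c ∈ ({c * r, c * r⁻¹, c} : Multiset ℂ).map ((-1 : ℂ) * ·) := by rw [h]; simp
  simp only [Multiset.insert_eq_cons, Multiset.map_cons, Multiset.map_singleton, Multiset.mem_cons,
    Multiset.mem_singleton, neg_mul, one_mul] at hmem
  have hr1 : r = -1 := by
    rcases hmem with h1 | h1 | h1
    · have : c * (1 + r) = 0 := by linear_combination h1
      rcases mul_eq_zero.1 this with h2 | h2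
      · exact absurd h2 hc
      · linear_combination h2
    · have h3 : c * r = -c := by
        have h4 := congrArg (· * r) h1
        simp only [neg_mul, inv_mul_cancel_right₀ hr] at h4
        exact h4
      have : c * (r + 1) = 0 := by linear_combination h3
      rcases mul_eq_zero.1 this with h2 | h2
      · exact absurd h2 hc
      · linear_combination h2
    · exact absurd (by linear_combination h1 / 2 : c = 0) hc
  subst hr1
  have hcount := congrArg (Multiset.count c) h
  simp only [Multiset.insert_eq_cons, Multiset.map_cons, Multiset.map_singleton, mul_neg, mul_one,
    neg_neg, inv_neg, inv_one, neg_mul, one_mul] at hcount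
  simp only [Multiset.count_cons, Multiset.count_singleton] at hcount
  have hcn : c ≠ -c := fun h' => hc (by linear_combination h' / 2)
  simp [hcn, eq_comm] at hcount

/-- A prime `𝔭 ∤ 3` of `K = ℚ(ω)` over `p ≡ 2 (mod 3)` has residue degree `2`. -/
theorem inertiaDeg_eq_two_of_mod {𝔭 : HeightOneSpectrum (𝓞 Kω)} {v : HeightOneSpectrum (𝓞 ℚ)}
    (hunder : 𝔭.asIdeal.under (𝓞 ℚ) = v.asIdeal) (h3 : (3 : 𝓞 Kω) ∉ 𝔭.asIdeal)
    (hp : ((((Rat.HeightOneSpectrum.primesEquiv v : Nat.Primes) : ℕ) : ZMod 3)) = 2) :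
    𝔭.asIdeal.inertiaDeg (𝓞 ℚ) = 2 := by
  obtain ⟨he1, he2, hN, -⟩ := residue_data hunder h3
  obtain ⟨ζ, hζ⟩ := exists_isPrimitiveRoot_three_cyclotomicField
  have h3dvd := three_dvd_residueCard_sub_one hζ h3
  rcases (show 𝔭.asIdeal.inertiaDeg (𝓞 ℚ) = 1 ∨ 𝔭.asIdeal.inertiaDeg (𝓞 ℚ) = 2 by omega) with he | he
  · exfalso
    rw [he, pow_one] at hN
    rw [hN] at h3dvd
    have h1 : 1 ≤ ((Rat.HeightOneSpectrum.primesEquiv v : Nat.Primes) : ℕ) :=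
      (Rat.HeightOneSpectrum.primesEquiv v).2.one_lt.le
    have hmod : ((((Rat.HeightOneSpectrum.primesEquiv v : Nat.Primes) : ℕ) : ZMod 3)) = 1 := by
      obtain ⟨c, hc⟩ := h3dvd
      have : ((Rat.HeightOneSpectrum.primesEquiv v : Nat.Primes) : ℕ) = 3 * c + 1 := by omega
      rw [this]; push_cast
      rw [show (3 : ZMod 3) = 0 from rfl]; ring
    rw [hmod] at hp
    exact absurd hp (by decide)
  · exact he

/-- **The automorphic side.** From a newform `g` of weight `w ≥ 2` and level `N` with `ρ̄_g`
non-dihedral (for every quadratic `K'`, infinitely many inert `v` with `a_v(g) ≢ 0`), a finite-order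
Hecke character `ω` and the four named facts: a regular algebraic cuspidal `P` on `GL₃/ℚ(ω)` whose Satake
parameters at almost every place `𝔭 ∣ v` of `ℚ(ω)` are `{c r, c r⁻¹, c}^{f(𝔭|v)}`-shaped with
`c = ω(ϖ_v) v^{…}` and `r + r⁻¹ + …` the adjoint data of `g` at `v` (precise form in the statement). -/
theorem automorphicSide (hGJ : GelbartJacquet_adjoint_lift_archimedean) (hNF : newform_archParameter)
    (hBC : baseChange_cyclic_cuspidal) (hAC : ArthurClozel1989_strongLifting_archimedean)
    {N : ℕ} [NeZero N] {w : ℕ} (hw : 2 ≤ w) {g : CuspForm (CongruenceSubgroup.Gamma1 N) (w : ℤ)}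
    (hg : IsNewform1 g)
    (hnd : ∀ (K' : Type) [Field K'] [NumberField K'] [Algebra ℚ K'], Module.finrank ℚ K' = 2 →
      {v : HeightOneSpectrum (𝓞 ℚ) | quadraticSign K' v = -1 ∧
        (UpperHalfPlane.qExpansion 1 ⇑g).coeff (Rat.HeightOneSpectrum.primesEquiv v) ≠ 0}.Infinite)
    (ω : Literature.NumberTheory.GaloisRepresentations.HeckeCharacter ℚ) (hω : ω.IsFiniteOrder)
    (hcpt : isCompact_glFiniteIntegralLevel 3 (CyclotomicField 3 ℚ)) :
    ∃ P : CuspidalAutomorphicRepData 3 (CyclotomicField 3 ℚ) hcpt, P.1.IsRegularAlgebraic ∧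
      ∀ᶠ 𝔭 : HeightOneSpectrum (𝓞 (CyclotomicField 3 ℚ)) in cofinite,
        ∃ (α : Multiset ℂ) (x y : ℂ) (v : HeightOneSpectrum (𝓞 ℚ)),
          𝔭.asIdeal.under (𝓞 ℚ) = v.asIdeal ∧ P.1.HasSatakeParamAt 𝔭 α ∧
          x + y = (UpperHalfPlane.qExpansion 1 ⇑g).coeff (Rat.HeightOneSpectrum.primesEquiv v) ∧
          x * y = (nebentypus g ((Rat.HeightOneSpectrum.primesEquiv v : ℕ) : ZMod N) : ℂ) *
            ((Rat.HeightOneSpectrum.primesEquiv v : ℕ) : ℂ) ^ (w - 1) ∧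
          (nebentypus g ((Rat.HeightOneSpectrum.primesEquiv v : ℕ) : ZMod N) : ℂ) ≠ 0 ∧
          α.map (fun a => (𝔭.residueCard : ℂ) * a) =
            ({ω.valueAtUniformizer v * x ^ 2 * ((nebentypus g ((Rat.HeightOneSpectrum.primesEquiv v : ℕ) : ZMod N) : ℂ))⁻¹,
              ω.valueAtUniformizer v * y ^ 2 * ((nebentypus g ((Rat.HeightOneSpectrum.primesEquiv v : ℕ) : ZMod N) : ℂ))⁻¹,
              ω.valueAtUniformizer v * ((Rat.HeightOneSpectrum.primesEquiv v : ℕ) : ℂ) ^ (w - 1)} : Multiset ℂ).map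
              (fun z => z ^ 𝔭.asIdeal.inertiaDeg (𝓞 ℚ)) := by
  classical
  have hk : (2 : ℤ) ≤ (w : ℤ) := by exact_mod_cast hw
  set hcpt₂ := isCompact_glFiniteIntegralLevel_holds 2 ℚ with hcpt₂def
  set hcpt₃ := isCompact_glFiniteIntegralLevel_holds 3 ℚ with hcpt₃def
  -- the cuspidal datum of `g`, its Satake parameters and infinity type
  obtain ⟨π, hπ⟩ := exists_repData_of_newform hk hg hcpt₂
  have hπarch : π.1.HasArchParameter fun _ => {(((w : ℤ) : ℂ) - 1) / 2, (1 - ((w : ℤ) : ℂ)) / 2} :=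
    hNF N (w : ℤ) hk g hg hcpt₂ π hπ
  -- non-dihedrality
  have hndih : ∀ (K' : Type) [Field K'] [NumberField K'] [Algebra ℚ K'], Module.finrank ℚ K' = 2 →
      ¬ IsQuadraticSelfTwistAE K' π.1 := by
    intro K' _ _ _ hK' hst
    have hcof : ∀ᶠ v : HeightOneSpectrum (𝓞 ℚ) in cofinite,
        ¬ (quadraticSign K' v = -1 ∧ (UpperHalfPlane.qExpansion 1 ⇑g).coeff (Rat.HeightOneSpectrum.primesEquiv v) ≠ 0) := by
      filter_upwards [hst, hπ] with v hv hπv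
      rintro ⟨hqs, hne⟩
      obtain ⟨α, β, hS, hsum, -⟩ := hπv
      have h := congrArg Multiset.sum (hv _ hS)
      rw [Multiset.sum_map_mul_left, hqs] at h
      have hzero : α + β = 0 := by
        have h' : -1 * ({α, β} : Multiset ℂ).sum = ({α, β} : Multiset ℂ).sum := h
        simp only [Multiset.insert_eq_cons, Multiset.sum_cons, Multiset.sum_singleton] at h'
        linear_combination (-1 / 2 : ℂ) * h'
      rw [hzero] at hsum
      have hp : (((Real.sqrt (Rat.HeightOneSpectrum.primesEquiv v : ℕ) : ℝ) : ℂ)) ≠ 0 := by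
        have := (Rat.HeightOneSpectrum.primesEquiv v).2.pos
        exact_mod_cast (Real.sqrt_pos.2 (by exact_mod_cast this)).ne'
      have heig : heckeEigenvalue g (Rat.HeightOneSpectrum.primesEquiv v) = 0 := by
        have := hsum.symm
        rwa [div_eq_zero_iff, or_iff_left (zpow_ne_zero _ hp)] at this
      apply hne
      rw [← IsNewform1.heckeEigenvalue_eq_coeff_holds hg (Rat.HeightOneSpectrum.primesEquiv v).2]
      exact heig
    rw [Filter.eventually_cofinite] at hcof
    exact (hnd K' hK') (by simpa using hcof)
  -- the adjoint lift with its infinity type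
  obtain ⟨P₀, hP₀S, hP₀A⟩ := hGJ ℚ hcpt₂ hcpt₃ π hndih
  have hP₀T : P₀.1.HasInfinityType (adInfinityType (w : ℤ)) := by
    refine ⟨isWellFormed_adInfinityType _, ?_⟩
    have h := hP₀A _ hπarch
    change P₀.1.HasArchParameter (fun σ => adArchParams _) at h
    simp only [adArchParams_dk] at h
    convert h using 1
    funext σ
    rw [map_a_adInfinityType]
  -- twist by `ω`
  set P₀' : CuspidalAutomorphicRepData 3 ℚ hcpt₃ := P₀.twist ω hω with hP₀'def
  have hP₀'S := P₀.1.eventually_hasSatakeParamAt_twist hω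
  have hP₀'T : P₀'.1.HasInfinityType (adInfinityType (w : ℤ)) :=
    ⟨isWellFormed_adInfinityType _, AutomorphicRepData.HasArchParameter.twist (π := P₀.1) ω hω hP₀T.2⟩
  -- twist by `|det|^{2-w}`
  obtain ⟨χ, P₁, hχ, hW, hW', hP₁T⟩ :=
    P₀'.exists_twist_hasInfinityType ((2 : ℝ) - (w : ℝ)) hP₀'T
  have hP₁S : ∀ {v : HeightOneSpectrum (𝓞 ℚ)} {α : Multiset ℂ}, P₀'.1.HasSatakeParamAt v α →
      P₁.1.HasSatakeParamAt v (α.map (((v.residueCard : ℂ) ^ (-(((2 : ℝ) - (w : ℝ) : ℝ) : ℂ))) * ·)) :=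
    fun h => AutomorphicRepData.HasSatakeParamAt.of_map_mulChar_detTwist_of_cpow hχ hW hW' h
  have hTra : ((adInfinityType (w : ℤ)).twist ((((2 : ℝ) - (w : ℝ) : ℝ) : ℂ))).IsRegularAlgebraic := by
    have : ((((2 : ℝ) - (w : ℝ) : ℝ) : ℂ)) = ((2 - (w : ℤ) : ℤ) : ℂ) := by push_cast; ring
    rw [this]
    exact isRegularAlgebraic_adInfinityType_twist hk _
  -- places where `p ∤ 3N`
  have hgoodN : ∀ᶠ v : HeightOneSpectrum (𝓞 ℚ) in cofinite,
      ¬ ((Rat.HeightOneSpectrum.primesEquiv v : Nat.Primes) : ℕ) ∣ N * 3 := by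
    rw [Filter.eventually_cofinite]
    have hT : {q : ℕ | q ∣ N * 3}.Finite :=
      (Nat.divisors (N * 3)).finite_toSet.subset fun q hq =>
        Nat.mem_divisors.2 ⟨hq, mul_ne_zero (NeZero.ne N) (by norm_num)⟩
    have hset : {v : HeightOneSpectrum (𝓞 ℚ) |
        ¬¬((Rat.HeightOneSpectrum.primesEquiv v : Nat.Primes) : ℕ) ∣ N * 3} =
        (fun v : HeightOneSpectrum (𝓞 ℚ) => ((Rat.HeightOneSpectrum.primesEquiv v : Nat.Primes) : ℕ)) ⁻¹'
          {q : ℕ | q ∣ N * 3} := by ext v; simp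
    rw [hset]
    exact hT.preimage fun x _ y _ hxy =>
      (Rat.HeightOneSpectrum.primesEquiv (R := 𝓞 ℚ)).injective (Subtype.ext hxy)
  -- the a.e. Satake description of `P₁`
  have hCne : ∀ v : HeightOneSpectrum (𝓞 ℚ),
      (v.residueCard : ℂ) ^ (-(((2 : ℝ) - (w : ℝ) : ℝ) : ℂ)) * ω.valueAtUniformizer v ≠ 0 := by
    intro v
    refine mul_ne_zero ?_ (heckeCharacter_valueAtUniformizer_ne_zero ω v)
    intro h
    rw [Complex.cpow_eq_zero_iff] at h
    exact (Nat.cast_ne_zero.2 (zero_lt_one.trans (HeightOneSpectrum.one_lt_residueCard v)).ne') h.1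
  have hP₁ae : ∀ᶠ v : HeightOneSpectrum (𝓞 ℚ) in cofinite, ∃ α₀ β₀ : ℂ,
      α₀ + β₀ = heckeEigenvalue g (Rat.HeightOneSpectrum.primesEquiv v) /
          (((Real.sqrt (Rat.HeightOneSpectrum.primesEquiv v : ℕ) : ℝ) : ℂ) ^ ((w : ℤ) - 1)) ∧
      α₀ * β₀ = nebentypus g (Rat.HeightOneSpectrum.primesEquiv v : ℕ) ∧ α₀ ≠ 0 ∧ β₀ ≠ 0 ∧
      ¬ ((Rat.HeightOneSpectrum.primesEquiv v : Nat.Primes) : ℕ) ∣ N * 3 ∧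
      P₁.1.HasSatakeParamAt v
        {((v.residueCard : ℂ) ^ (-(((2 : ℝ) - (w : ℝ) : ℝ) : ℂ)) * ω.valueAtUniformizer v) * (α₀ * β₀⁻¹),
          ((v.residueCard : ℂ) ^ (-(((2 : ℝ) - (w : ℝ) : ℝ) : ℂ)) * ω.valueAtUniformizer v) * (α₀ * β₀⁻¹)⁻¹,
          (v.residueCard : ℂ) ^ (-(((2 : ℝ) - (w : ℝ) : ℝ) : ℂ)) * ω.valueAtUniformizer v} := by
    filter_upwards [hπ, hP₀S, hP₀'S, hgoodN] with v hπv h0 h0' hvN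
    obtain ⟨α₀, β₀, hS, hsum, hprod⟩ := hπv
    have hcop : ((Rat.HeightOneSpectrum.primesEquiv v : Nat.Primes) : ℕ).Coprime N :=
      (Nat.Prime.coprime_iff_not_dvd (Rat.HeightOneSpectrum.primesEquiv v).2).2
        fun h => hvN (dvd_mul_of_dvd_left h 3)
    have hεne : (nebentypus g (Rat.HeightOneSpectrum.primesEquiv v : ℕ) : ℂ) ≠ 0 :=
      (((ZMod.isUnit_iff_coprime _ _).2 hcop).map (nebentypus g)).ne_zero
    have hαβ : α₀ * β₀ ≠ 0 := by rw [hprod]; exact hεne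
    have hα : α₀ ≠ 0 := left_ne_zero_of_mul hαβ
    have hβ : β₀ ≠ 0 := right_ne_zero_of_mul hαβ
    have h1 := h0 _ hS
    rw [adParams_pair hα hβ] at h1
    have h2 := h0' _ h1
    have h3 := hP₁S h2
    have hinv : (α₀ * β₀⁻¹)⁻¹ = β₀ * α₀⁻¹ := by rw [_root_.mul_inv_rev, inv_inv]
    rw [← hinv, adjoint_triple_map_map] at h3
    exact ⟨α₀, β₀, hsum, hprod, hα, hβ, hvN, h3⟩
  -- one inert place with an adjoint-shaped Satake parameter
  have hne : ∃ (v : HeightOneSpectrum (𝓞 ℚ)) (u : HeightOneSpectrum (𝓞 Kω)) (α : Multiset ℂ),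
      u.asIdeal.under (𝓞 ℚ) = v.asIdeal ∧ u.asIdeal.inertiaDeg (𝓞 ℚ) = Module.finrank ℚ Kω ∧
      P₁.1.HasSatakeParamAt v α ∧ ∀ ζ : ℂ, IsPrimitiveRoot ζ (Module.finrank ℚ Kω) → α.map (ζ * ·) ≠ α := by
    have hinf : {v : HeightOneSpectrum (𝓞 ℚ) |
        ((((Rat.HeightOneSpectrum.primesEquiv v : Nat.Primes) : ℕ) : ZMod 3)) = 2}.Infinite := by
      have h := Nat.infinite_setOf_prime_and_eq_mod (q := 3) (a := 2) (by decide)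
      intro hSfin
      apply h
      refine (hSfin.image fun v : HeightOneSpectrum (𝓞 ℚ) =>
        ((Rat.HeightOneSpectrum.primesEquiv v : Nat.Primes) : ℕ)).subset ?_
      rintro q ⟨hq, hq2⟩
      refine ⟨(Rat.HeightOneSpectrum.primesEquiv (R := 𝓞 ℚ)).symm ⟨q, hq⟩, ?_, ?_⟩
      · simp only [Set.mem_setOf_eq, Equiv.apply_symm_apply]
        exact hq2
      · simp
    have hfin : {v : HeightOneSpectrum (𝓞 ℚ) | ¬ (∃ α₀ β₀ : ℂ,
      α₀ + β₀ = heckeEigenvalue g (Rat.HeightOneSpectrum.primesEquiv v) /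
          (((Real.sqrt (Rat.HeightOneSpectrum.primesEquiv v : ℕ) : ℝ) : ℂ) ^ ((w : ℤ) - 1)) ∧
      α₀ * β₀ = nebentypus g (Rat.HeightOneSpectrum.primesEquiv v : ℕ) ∧ α₀ ≠ 0 ∧ β₀ ≠ 0 ∧
      ¬ ((Rat.HeightOneSpectrum.primesEquiv v : Nat.Primes) : ℕ) ∣ N * 3 ∧
      P₁.1.HasSatakeParamAt v
        {((v.residueCard : ℂ) ^ (-(((2 : ℝ) - (w : ℝ) : ℝ) : ℂ)) * ω.valueAtUniformizer v) * (α₀ * β₀⁻¹),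
          ((v.residueCard : ℂ) ^ (-(((2 : ℝ) - (w : ℝ) : ℝ) : ℂ)) * ω.valueAtUniformizer v) * (α₀ * β₀⁻¹)⁻¹,
          (v.residueCard : ℂ) ^ (-(((2 : ℝ) - (w : ℝ) : ℝ) : ℂ)) * ω.valueAtUniformizer v})}.Finite := by
      rwa [Filter.eventually_cofinite] at hP₁ae
    obtain ⟨v, hv2, hv⟩ := (hinf.sdiff hfin).nonempty
    simp only [Set.mem_setOf_eq, not_not] at hv
    obtain ⟨α₀, β₀, -, -, hα, hβ, hvN, hS⟩ := hv
    obtain ⟨u, hu⟩ := exists_above (E := Kω) v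
    refine ⟨v, u, _, hu, ?_, hS, ?_⟩
    · rw [finrank_Kω]
      exact inertiaDeg_eq_two_of_mod hu (three_not_mem hu hvN) hv2
    · intro ζ hζ
      rw [finrank_Kω] at hζ
      rw [hζ.eq_neg_one_of_two_right]
      exact map_neg_ne_of_adjoint (hCne v) (mul_ne_zero hα (inv_ne_zero hβ))
  -- base change to `K`
  haveI : IsCyclotomicExtension {3} ℚ Kω := CyclotomicField.isCyclotomicExtension 3 ℚ
  haveI : IsGalois ℚ Kω := IsCyclotomicExtension.isGalois {3} ℚ Kω
  obtain ⟨P, hlift, -, hPra⟩ := exists_cuspidal_regularAlgebraic_baseChange hBC hAC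
    (by rw [finrank_Kω]; norm_num) P₁ hP₁T hTra hne hcpt
  refine ⟨P, hPra, ?_⟩
  filter_upwards [hlift, eventually_over hP₁ae] with 𝔭 hl h𝔭
  set v : HeightOneSpectrum (𝓞 ℚ) := 𝔭.under (𝓞 ℚ) with hvdef
  have hunder : 𝔭.asIdeal.under (𝓞 ℚ) = v.asIdeal := rfl
  obtain ⟨α₀, β₀, hsum, hprod, hα, hβ, hvN, hS⟩ := h𝔭 v hunder
  have hSat := hl v _ hunder hS
  set p : ℕ := ((Rat.HeightOneSpectrum.primesEquiv v : Nat.Primes) : ℕ) with hpdef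
  have hp : p.Prime := (Rat.HeightOneSpectrum.primesEquiv v).2
  set r : ℂ := ((Real.sqrt (p : ℝ) : ℝ) : ℂ) with hrdef
  have hr2 : r ^ 2 = (p : ℂ) := by
    rw [hrdef, ← Complex.ofReal_pow, Real.sq_sqrt (Nat.cast_nonneg _)]
    simp
  have hr0 : r ≠ 0 := by
    rw [hrdef]; exact_mod_cast (Real.sqrt_pos.2 (by exact_mod_cast hp.pos)).ne'
  have hzpow : r ^ ((w : ℤ) - 1) = r ^ (w - 1) := by
    rw [show ((w : ℤ) - 1) = ((w - 1 : ℕ) : ℤ) by omega, zpow_natCast]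
  have hrw : r ^ (w - 1) * r ^ (w - 1) = (p : ℂ) ^ (w - 1) := by
    rw [← mul_pow, ← sq, hr2]
  have hq : (v.residueCard : ℂ) = (p : ℂ) := by rw [residueCard_eq_primesEquiv]
  have hcpow : (v.residueCard : ℂ) ^ (-(((2 : ℝ) - (w : ℝ) : ℝ) : ℂ)) = (p : ℂ) ^ (w - 2) := by
    rw [hq, show (-(((2 : ℝ) - (w : ℝ) : ℝ) : ℂ)) = ((w - 2 : ℕ) : ℂ) by push_cast [Nat.cast_sub hw]; ring,
      Complex.cpow_natCast]
  have hεne : (nebentypus g (p : ZMod N) : ℂ) ≠ 0 := by rw [← hprod]; exact mul_ne_zero hα hβ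
  refine ⟨_, r ^ (w - 1) * α₀, r ^ (w - 1) * β₀, v, hunder, hSat, ?_, ?_, hεne, ?_⟩
  · rw [← mul_add, hsum, hzpow, mul_div_cancel₀ _ (pow_ne_zero _ hr0)]
    exact IsNewform1.heckeEigenvalue_eq_coeff_holds hg hp
  · calc r ^ (w - 1) * α₀ * (r ^ (w - 1) * β₀) = (r ^ (w - 1) * r ^ (w - 1)) * (α₀ * β₀) := by ring
      _ = _ := by rw [hrw, hprod, mul_comm]
  · rw [Multiset.map_map, residueCard_eq_pow hunder, ← hpdef, hcpow]
    have hfun : ((fun a : ℂ => ((p ^ 𝔭.asIdeal.inertiaDeg (𝓞 ℚ) : ℕ) : ℂ) * a) ∘ fun z : ℂ => z ^ 𝔭.asIdeal.inertiaDeg (𝓞 ℚ)) =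
        (fun z : ℂ => z ^ 𝔭.asIdeal.inertiaDeg (𝓞 ℚ)) ∘ fun z : ℂ => (p : ℂ) * z := by
      funext z; simp [mul_pow]
    rw [hfun, ← Multiset.map_map]
    congr 1
    simp only [Multiset.insert_eq_cons, Multiset.map_cons, Multiset.map_singleton]
    have hpw : (p : ℂ) * (p : ℂ) ^ (w - 2) = (p : ℂ) ^ (w - 1) := by
      rw [← pow_succ', show w - 2 + 1 = w - 1 by omega]
    have hrw2 : (r ^ (w - 1)) ^ 2 = (p : ℂ) ^ (w - 1) := by rw [sq, hrw]
    have hc : (p : ℂ) ^ (w - 2) * ω.valueAtUniformizer v ≠ 0 := by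
      rw [← hcpow]; exact hCne v
    have e1 : (p : ℂ) * ((p : ℂ) ^ (w - 2) * ω.valueAtUniformizer v * (α₀ * β₀⁻¹)) =
        ω.valueAtUniformizer v * (r ^ (w - 1) * α₀) ^ 2 * ((nebentypus g (p : ZMod N) : ℂ))⁻¹ := by
      rw [← hprod, mul_pow, hrw2, ← hpw]
      field_simp
    have e2 : (p : ℂ) * ((p : ℂ) ^ (w - 2) * ω.valueAtUniformizer v * (α₀ * β₀⁻¹)⁻¹) =
        ω.valueAtUniformizer v * (r ^ (w - 1) * β₀) ^ 2 * ((nebentypus g (p : ZMod N) : ℂ))⁻¹ := by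
      rw [← hprod, mul_pow, hrw2, ← hpw]
      field_simp
    have e3 : (p : ℂ) * ((p : ℂ) ^ (w - 2) * ω.valueAtUniformizer v) =
        ω.valueAtUniformizer v * (p : ℂ) ^ (w - 1) := by
      rw [← hpw]; ring
    rw [e1, e2, e3]

end AutomorphicSide

end Summit.Langlands.Langlands.Theorems.ResidualAutomorphyOdd
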